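import Literature.NumberTheory.ModularSymbols.CuspidalHomologyHeckeTransfer
import HarnessLib

/-!
# Independence of coset representatives for the Hecke transfer sum `T_q{∞, γ∞} = Σᵢ {∞, γ'ᵢ∞}` on `H₁(X₀(N), ℤ)`

Topic `Literature/NumberTheory/ModularSymbols`; namespace `Literature.NumberTheory.ModularSymbols`.  Proved theorems only; no
definition, no named fact, no `sorry`.

The tree computes `T_q` on the integral modular symbols with the FIXED representatives `βᵢ` (`heckeRep`) of
`Γ₀(N) diag(1,q) Γ₀(N) = ⊔ᵢ Γ₀(N)βᵢ` and the attached data `βᵢγ = γ'ᵢ β_{σ_γ(i)}` (`heckePermElt`, `heckePerm`;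
`CuspidalHomologyHeckeTransfer.T_smul_symbolInt_eq_sum`).  This file proves the classical remark that ANY choice of
representatives gives the same operator on homology (Shimura §3.1–3.2 / Knapp Prop. 11.23 "independent of the choice of the
`αᵢ`"):

* `heckePerm_eq_of_mul_eq` / `heckePermElt_eq_of_mul_eq`: uniqueness of the data — if `δ β_j = βᵢ γ` with `δ ∈ Γ₀(N)` then
  `j = σ_γ(i)` and `δ = γ'ᵢ`.
* **`sum_symbolInt_eq_T_smul_of_reps`**: for representatives `β'_a = g_a β_{e(a)}` (`g_a ∈ Γ₀(N)`, `e : ι ≃ I_q(N)`) and ANY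
  data `γ''_a ∈ Γ₀(N)`, `τ : ι ≃ ι` with `γ''_a β'_{τ a} = β'_a γ`, one has `Σ_a {∞, γ''_a ∞} = T_q {∞, γ∞}`
  (telescoping `Σ_a {∞, g_a∞} − Σ_a {∞, g_{τ a}∞} = 0`); `R`-coefficient version `sum_symbol_eq_heckeOp_of_reps`.

Consumer: the comparison of the Hecke operator on the full-level carrier `H₁(Γ₀(M), k[GL₂(ℤ/p)])`
(`FullLevelHomologyHeckeChain.heckeT`, representatives at level `M`) with the tree's `T_q` on `H(p²M; k)` under the up/down
dictionary `diag(p,1)`-conjugation (route BSD/TeichmullerTwistDescent, K-line step (S2)); not done here.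

## References
* G. Shimura, *Introduction to the arithmetic theory of automorphic functions* (1971), §3.1 (double cosets, independence of
  representatives), §8.3 (8.3.2). [Shimura1971]
* A. W. Knapp, *Elliptic Curves* (1993), Prop. 11.23 and (11.38). [Knapp1993]
-/

noncomputable section

open scoped MatrixGroups
open CongruenceSubgroup Matrix
open Literature.NumberTheory.EllipticCurves.ModularForms

namespace Literature.NumberTheory.ModularSymbols

section Uniqueness

variable {N : ℕ} {q : ℕ} (hq : q.Prime)

/-- **Uniqueness of the coset permutation**: if `δ β_j = βᵢ γ` with `δ ∈ Γ₀(N)` then `j = σ_γ(i)`.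
[cite: Shimura1971, §3.1] -/
theorem heckePerm_eq_of_mul_eq (γ δ : Gamma0 N) (i j : HeckeIdx N q)
    (h : ((δ : SL(2, ℤ)) : Matrix (Fin 2) (Fin 2) ℤ) * heckeRep q j.1 =
      heckeRep q i.1 * ((γ : SL(2, ℤ)) : Matrix (Fin 2) (Fin 2) ℤ)) :
    heckePerm hq γ i = j :=
  (existsUnique_heckeRep_mul_coe hq γ i).unique
    ⟨_, coe_mem_delta0_one (heckePermElt hq γ i), heckePermElt_spec hq γ i⟩ ⟨_, coe_mem_delta0_one δ, h⟩

/-- **Uniqueness of the coset elements**: if `δ β_j = βᵢ γ` with `δ ∈ Γ₀(N)` then `δ = γ'ᵢ`. [cite: Shimura1971, §3.1] -/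
theorem heckePermElt_eq_of_mul_eq (γ δ : Gamma0 N) (i j : HeckeIdx N q)
    (h : ((δ : SL(2, ℤ)) : Matrix (Fin 2) (Fin 2) ℤ) * heckeRep q j.1 =
      heckeRep q i.1 * ((γ : SL(2, ℤ)) : Matrix (Fin 2) (Fin 2) ℤ)) :
    heckePermElt hq γ i = δ := by
  have hj := heckePerm_eq_of_mul_eq hq γ δ i j h
  have h1 := heckePermElt_spec hq γ i
  rw [hj, ← h] at h1
  have h2 := matrix_mul_right_cancel_of_det_ne_zero (det_heckeRep_ne_zero hq.ne_zero j.1) h1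
  exact Subtype.ext (Matrix.SpecialLinearGroup.ext _ _ fun a b => congrFun (congrFun h2 a) b)

end Uniqueness

section Independence

variable (N : ℕ) [NeZero N] {q : ℕ} [NeZero q] (hq : q.Prime)

/-- **Independence of representatives for the Hecke transfer sum on `H₁(X₀(N), ℤ)`.**  Let `β'_a = g_a β_{e(a)}`
(`g_a ∈ Γ₀(N)`, `e : ι ≃ I_q(N)`) be any system of representatives of `Γ₀(N)\Γ₀(N)diag(1,q)Γ₀(N)` and `γ''_a ∈ Γ₀(N)`,
`τ : ι ≃ ι` any data with `γ''_a β'_{τ a} = β'_a γ`.  Then `Σ_a {∞, γ''_a∞} = T_q{∞, γ∞}`.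
[cite: Shimura1971, §3.1 and §8.3 (8.3.2); Knapp1993, Prop. 11.23] -/
theorem sum_symbolInt_eq_T_smul_of_reps {ι : Type} [Fintype ι] (e : ι ≃ HeckeIdx N q) (g : ι → Gamma0 N)
    (γ : Gamma0 N) (γ'' : ι → Gamma0 N) (τ : ι ≃ ι)
    (h : ∀ a, ((γ'' a : SL(2, ℤ)) : Matrix (Fin 2) (Fin 2) ℤ) *
        (((g (τ a) : SL(2, ℤ)) : Matrix (Fin 2) (Fin 2) ℤ) * heckeRep q (e (τ a)).1) =
      (((g a : SL(2, ℤ)) : Matrix (Fin 2) (Fin 2) ℤ) * heckeRep q (e a).1) * ((γ : SL(2, ℤ)) : Matrix (Fin 2) (Fin 2) ℤ)) :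
    ∑ a, symbolInt N (γ'' a) = HeckeRing0.T N 2 q hq • symbolInt N γ := by
  -- `(g_a⁻¹ γ''_a g_{τ a}) β_{e τ a} = β_{e a} γ`, hence `g_a⁻¹ γ''_a g_{τ a} = γ'_{e a}`
  have key : ∀ a, heckePermElt hq γ (e a) = (g a)⁻¹ * γ'' a * g (τ a) := fun a => by
    apply heckePermElt_eq_of_mul_eq hq γ _ (e a) (e (τ a))
    have hg : (((g a)⁻¹ : Gamma0 N) : SL(2, ℤ)) = ((g a : SL(2, ℤ)))⁻¹ := rfl
    rw [Subgroup.coe_mul, Subgroup.coe_mul, Matrix.SpecialLinearGroup.coe_mul, Matrix.SpecialLinearGroup.coe_mul,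
      Matrix.mul_assoc, Matrix.mul_assoc, h a, ← Matrix.mul_assoc, ← Matrix.mul_assoc, hg,
      Matrix.SpecialLinearGroup.coe_inv, Matrix.adjugate_mul, Matrix.SpecialLinearGroup.det_coe, one_smul,
      Matrix.one_mul]
  have hγ'' : ∀ a, γ'' a = g a * heckePermElt hq γ (e a) * (g (τ a))⁻¹ := fun a => by
    rw [key]; group
  calc ∑ a, symbolInt N (γ'' a)
      = ∑ a, (symbolInt N (g a) + symbolInt N (heckePermElt hq γ (e a)) - symbolInt N (g (τ a))) := by
        refine Finset.sum_congr rfl fun a _ => ?_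
        rw [hγ'' a, symbolInt_mul, symbolInt_mul, symbolInt_inv, sub_eq_add_neg]
    _ = ∑ a, symbolInt N (g a) + ∑ a, symbolInt N (heckePermElt hq γ (e a)) - ∑ a, symbolInt N (g (τ a)) := by
        rw [Finset.sum_sub_distrib, Finset.sum_add_distrib]
    _ = ∑ a, symbolInt N (heckePermElt hq γ (e a)) := by
        rw [Equiv.sum_comp τ (fun a => symbolInt N (g a))]; abel
    _ = ∑ i, symbolInt N (heckePermElt hq γ i) := Equiv.sum_comp e (fun i => symbolInt N (heckePermElt hq γ i))
    _ = HeckeRing0.T N 2 q hq • symbolInt N γ := (T_smul_symbolInt_eq_sum N hq γ).symm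

/-- The same over a coefficient ring `R`: `Σ_a ({∞, γ''_a∞} ⊗ 1) = T_q ({∞, γ∞} ⊗ 1)` in `H(N; R)`.
[cite: Shimura1971, §3.1 and §8.3 (8.3.2)] -/
theorem sum_symbol_eq_heckeOp_of_reps (R : Type) [CommRing R] {ι : Type} [Fintype ι] (e : ι ≃ HeckeIdx N q)
    (g : ι → Gamma0 N) (γ : Gamma0 N) (γ'' : ι → Gamma0 N) (τ : ι ≃ ι)
    (h : ∀ a, ((γ'' a : SL(2, ℤ)) : Matrix (Fin 2) (Fin 2) ℤ) *
        (((g (τ a) : SL(2, ℤ)) : Matrix (Fin 2) (Fin 2) ℤ) * heckeRep q (e (τ a)).1) =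
      (((g a : SL(2, ℤ)) : Matrix (Fin 2) (Fin 2) ℤ) * heckeRep q (e a).1) * ((γ : SL(2, ℤ)) : Matrix (Fin 2) (Fin 2) ℤ)) :
    ∑ a, symbol N R (γ'' a) = heckeOp N R q hq (symbol N R γ) := by
  simp only [symbol_def]
  rw [← TensorProduct.tmul_sum, sum_symbolInt_eq_T_smul_of_reps N hq e g γ γ'' τ h, heckeOp_def,
    hecke_eq_baseChange]
  rfl

end Independence

end Literature.NumberTheory.ModularSymbols
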